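/-
Copyright: b2b-lace packet (CARVER gen 40, census v5 "slack ledger", node D10H-TKU / ATOM-DEVICES).
A d-generic Cauchy–Schwarz PAIRING bound for the SRW-table cell `T_{n,l}(x)` of [NoBLE17-I] (3.37) that
avoids the triangle-inequality step `|M̂| ≤ |D̂| + 2 D̂^{sin} Ĉ` of (5.10)–(5.11), together with the exact
`x`-space evaluation of its new partner integral `M₂` in terms of the paper's own `I`, `V` ((3.35), (5.8)).
Elementary; hypothesis-free; no `sorry`; no statement at any specific dimension.
-/
import Literature.Probability.FitznerVanDerHofstad2017.SrwIntegralVEval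
import HarnessLib

/-!
# A Cauchy–Schwarz pairing for `T_{n,l}(x)` and the `M̂`-second-moment integral `M₂`

CITATION HEADER (PLACEMENT v2). Part of the certified REPRODUCTION of the numerical inputs of
R. Fitzner, R. van der Hofstad, *Generalized approach to the non-backtracking lace expansion*,
Probab. Theory Related Fields 169 (2017) 1041–1119 [NoBLE17-I] (arXiv:1506.07969), §3.3.3 and §5.2
((3.35)–(3.38) p. 1071; (5.7)–(5.11) p. 1091–1092), as consumed by *Mean-field behavior for
nearest-neighbor percolation in `d > 10`*, Electron. J. Probab. 22 (2017) no. 43 [FvdH17].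
Origin: build `lace`, unit `b2b-lace-carver-g40` (census v5: the slack of the printed SRW-atom devices).
Nothing here is a statement about percolation and nothing is evaluated at a specific `d`.

## What is proved, and why

[NoBLE17-I] §5.2 bounds `T_{n,l}(x) = ∫ |D̂|^l Ĉⁿ |D̂^{(x)}| |M̂|`, `M̂ = D̂ − 2 D̂^{sin} Ĉ` ((3.26)), in two
steps: the pointwise triangle inequality `|M̂| ≤ |D̂| + min{4/d, 2Ĉ/d}` ((5.10)–(5.11), the tree's
`srwT_le_four` / `srwT_le_two`), then Cauchy–Schwarz on each resulting `K` ((5.9)).  The first step discards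
the cancellation inside `M̂` (near `k = 0`, `D̂ ≈ 1` while `2 D̂^{sin} Ĉ ≈ 4/d`).  Pairing instead

  `|D̂|^{m+j} |D̂^{(x)}| |M̂| Ĉ^{α+β} = (|D̂|^m |M̂| Ĉ^α) · (|D̂|^j |D̂^{(x)}| Ĉ^β)`

and applying Cauchy–Schwarz ONCE gives, with the same proof as (5.9) ([HS92b] (B.25)–(B.27); the tree's
`srwK_le_sqrt_srwI_mul_srwW`),

  `T_{α+β, m+j}(x) ≤ [M₂_{2α,m}]^{1/2} [W_{2β,j}(x)]^{1/2}`      (`srwT_le_sqrt_srwM2_mul_srwW`),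
  `M₂_{c,m} := ∫ D̂^{2m} M̂² Ĉ^c dk/(2π)^d`                     (`srwM2`),

valid at every fixed `x` whenever both factors are integrable (`d ≥ 4α + 1`, `d ≥ 4β + 1`).  The partner
`M₂` keeps the cancellation inside `M̂` exactly, and it is `x`-SPACE COMPUTABLE from the paper's own
objects: expanding `M̂² = D̂² − 4 D̂ D̂^{sin} Ĉ + 4 (D̂^{sin})² Ĉ²` and using `D̂^{sin} = (2d)⁻¹(1 − D̂^{(2e_i)})`
(§5.2 p. 1093; the tree's `Dsin_eq_half_angle`, `DhatSym_single_two`),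

  `M₂_{c,m} = I_{c,2m+2}(0) − (2/d) [I_{c+1,2m+1}(0) − I_{c+1,2m+1}(2e_i)] + 4 V_{c+2,2m}`   (`srwM2_eq`),

for `d ≥ 2(c+2) + 1` (each piece integrable; (5.13)/`srwV_even_eq` then expresses `V` through `I`, `W`).
The pairing is NOT the source's route and is not in print for `T` (the source has no need: at `d ≥ 11`
its devices suffice); it is recorded here as an elementary kernel lemma, not as a cited fact.  Float
sampling in the originating unit (what-if, not a certificate) indicates the pairing is within a factor
`1.01–1.12` of `T_{n,l}(x)` at `x ∈ {0, e₁}` and `1.3–1.8` on the axes `2e₁`, `3e₁` at the SRW-table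
parameter `10`, against `2.4–4.8` for (5.10)–(5.11)+(5.9); that comparison is provenance-only prose.

## What is here
* `srwM2` and its integrability (`integrable_srwM2_integrand`; nonnegativity is a private helper);
* the pointwise AM–GM step `srwT_integrand_le_pairing` and **`srwT_le_sqrt_srwM2_mul_srwW`**
  (+ the `j = 0` form against `L_{2β}(x)`, `srwT_le_sqrt_srwM2_mul_srwL`);
* the pointwise expansion `srwM2_integrand_eq` and **`srwM2_eq`**.

## References
* [NoBLE17-I] R. Fitzner, R. van der Hofstad, PTRF 169 (2017) 1041–1119; arXiv:1506.07969 — (3.26), (3.35)–(3.38)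
  p. 1070–1071; §5.2 (5.7)–(5.13) p. 1091–1093.
* [HS92b] T. Hara, G. Slade, *The lace expansion for self-avoiding walk in five or more dimensions*,
  Rev. Math. Phys. 4 (1992) 235–327 — Lemma B.3, (B.25)–(B.27) (the Schwarz-inequality device).
-/

open MeasureTheory Real Finset
open scoped BigOperators

namespace Literature.Probability.FitznerVanDerHofstad2017

open Literature.Barriers.CriticalPhenomena
open Literature.Barriers.CriticalPhenomena.Slade2006Prop53 (P)

variable {d : ℕ}

/-! ### The `M̂`-second-moment integral `M₂_{c,m}` -/

/-- `M₂_{c,m} = ∫_{[-π,π]^d} D̂(k)^{2m} M̂(k)² Ĉ(k)^c dk/(2π)^d`, the Cauchy–Schwarz partner of `W_{n,j}(x)`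
for `T_{n,l}(x)` (a Bochner integral: meaningful for `d ≥ 2c + 1`).  Not an object of the source; the
notation follows (3.35)–(3.38). [folklore] -/
noncomputable def srwM2 (d c m : ℕ) : ℝ :=
  (∫ k, (Dhat d k ^ (2 * m) * Mhat d k ^ 2) * Chat d 1 k ^ c ∂P d) / (2 * π) ^ d

/-- `|M̂| ≤ 5` (crudely: `|M̂| ≤ |D̂| + 4/d ≤ 1 + 4`). [cite: FitznerVanDerHofstad2016NoBLE, §5.2 (5.10) p. 1092] -/
theorem abs_Mhat_le_five (hd : 1 ≤ d) (k : Fin d → ℝ) : |Mhat d k| ≤ 5 := by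
  have hd0 : (1 : ℝ) ≤ d := by exact_mod_cast hd
  have h1 : |Dhat d k| ≤ 1 := by simpa using abs_Dhat_pow_le_one 1 k
  have h2 : 2 * Dsin d k * Chat d 1 k ≤ 4 / d := two_mul_Dsin_mul_Chat_le hd k
  have h3 : (4 : ℝ) / d ≤ 4 := by
    rw [div_le_iff₀ (by linarith)]
    linarith
  linarith [abs_Mhat_le k]

/-- The `M₂`-integrand is integrable for `d ≥ 2c + 1` (bounded weight times `Ĉ^c`, [HvdH17] Prop. 5.5 via the tree's
`integrable_weight_mul_Chat_pow`). [cite: HeydenreichVanDerHofstad2017, Prop. 5.5] -/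
theorem integrable_srwM2_integrand {c : ℕ} (hd : 2 * c + 1 ≤ d) (m : ℕ) :
    Integrable (fun k => (Dhat d k ^ (2 * m) * Mhat d k ^ 2) * Chat d 1 k ^ c) (P d) := by
  have hd1 : 1 ≤ d := by omega
  have h := integrable_weight_mul_Chat_pow hd (w := fun k => (Dhat d k ^ (2 * m) * Mhat d k ^ 2) / 25)
    ((((continuous_Dhat d).measurable.pow_const (2 * m)).mul ((measurable_Mhat d).pow_const 2)).div_const 25)
    fun k => by
      rw [abs_div, abs_mul, abs_pow, abs_pow, abs_of_pos (by norm_num : (0 : ℝ) < 25), div_le_one (by norm_num)]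
      have hM : |Mhat d k| ^ 2 ≤ 5 ^ 2 := pow_le_pow_left₀ (abs_nonneg _) (abs_Mhat_le_five hd1 k) 2
      have hD : |Dhat d k| ^ (2 * m) ≤ 1 := abs_Dhat_pow_le_one (2 * m) k
      nlinarith [pow_nonneg (abs_nonneg (Dhat d k)) (2 * m), pow_nonneg (abs_nonneg (Mhat d k)) 2]
  refine (h.const_mul 25).congr (ae_of_all _ fun k => ?_)
  simp only
  ring

/-- `M₂_{c,m} ≥ 0` (private helper). [folklore] -/
private theorem srwM2_nonneg (c m : ℕ) : 0 ≤ srwM2 d c m :=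
  div_nonneg (integral_nonneg fun k => mul_nonneg
    (mul_nonneg (by rw [pow_mul]; exact pow_nonneg (sq_nonneg _) m) (sq_nonneg _))
    (pow_nonneg (Chat_one_nonneg k) c)) (two_pi_pow_pos d).le

/-! ### The pairing bound -/

/-- Pointwise AM–GM behind the pairing: for `λ > 0`,
`|D̂|^{m+j} |D̂^{(x)}| |M̂| Ĉ^{α+β} ≤ (λ · D̂^{2m} M̂² Ĉ^{2α} + λ⁻¹ · D̂^{2j} (D̂^{(x)})² Ĉ^{2β}) / 2`.
[cite: FitznerVanDerHofstad2016NoBLE, §5.2 (5.9) p. 1091] -/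
theorem srwT_integrand_le_pairing (α β m j : ℕ) (x : Fin d → ℤ) (k : Fin d → ℝ) {lam : ℝ} (hl : 0 < lam) :
    (|Dhat d k| ^ (m + j) * |DhatSym d x k| * |Mhat d k|) * Chat d 1 k ^ (α + β) ≤
      (lam * ((Dhat d k ^ (2 * m) * Mhat d k ^ 2) * Chat d 1 k ^ (2 * α)) +
        lam⁻¹ * ((Dhat d k ^ (2 * j) * DhatSym d x k ^ 2) * Chat d 1 k ^ (2 * β))) / 2 := by
  have hC := Chat_one_nonneg k
  have h := abs_mul_abs_le_am_gm (Dhat d k ^ m * Mhat d k * Chat d 1 k ^ α)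
    (Dhat d k ^ j * DhatSym d x k * Chat d 1 k ^ β) hl
  have e1 : |Dhat d k ^ m * Mhat d k * Chat d 1 k ^ α| * |Dhat d k ^ j * DhatSym d x k * Chat d 1 k ^ β| =
      (|Dhat d k| ^ (m + j) * |DhatSym d x k| * |Mhat d k|) * Chat d 1 k ^ (α + β) := by
    simp only [abs_mul, abs_pow, abs_of_nonneg hC]
    ring
  rw [e1] at h
  refine h.trans (le_of_eq ?_)
  ring

/-- **Pairing bound**: `T_{α+β, m+j}(x) ≤ [M₂_{2α,m}]^{1/2} [W_{2β,j}(x)]^{1/2}` (`d ≥ 4α + 1`, `d ≥ 4β + 1`):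
Cauchy–Schwarz with the split `(|D̂|^m |M̂| Ĉ^α) · (|D̂|^j |D̂^{(x)}| Ĉ^β)` — the triangle step (5.10)–(5.11)
is not used. [cite: FitznerVanDerHofstad2016NoBLE, §5.2 (5.9) p. 1091] -/
theorem srwT_le_sqrt_srwM2_mul_srwW {α β : ℕ} (hα : 2 * (2 * α) + 1 ≤ d) (hβ : 2 * (2 * β) + 1 ≤ d)
    (m j : ℕ) (x : Fin d → ℤ) :
    srwT d (α + β) (m + j) x ≤ Real.sqrt (srwM2 d (2 * α) m) * Real.sqrt (srwW d (2 * β) j x) := by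
  refine le_sqrt_mul_sqrt_of_forall (srwM2_nonneg (2 * α) m) (srwW_nonneg (2 * β) j x) fun lam hl => ?_
  have hA := integrable_srwM2_integrand hα m (d := d)
  have hB := integrable_srwW_integrand hβ j x
  have key : ∫ k, (|Dhat d k| ^ (m + j) * |DhatSym d x k| * |Mhat d k|) * Chat d 1 k ^ (α + β) ∂P d ≤
      ∫ k, (lam * ((Dhat d k ^ (2 * m) * Mhat d k ^ 2) * Chat d 1 k ^ (2 * α)) +
        lam⁻¹ * ((Dhat d k ^ (2 * j) * DhatSym d x k ^ 2) * Chat d 1 k ^ (2 * β))) / 2 ∂P d := by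
    refine integral_mono_of_nonneg (ae_of_all _ fun k => ?_)
      (((hA.const_mul lam).add (hB.const_mul lam⁻¹)).div_const 2)
      (ae_of_all _ fun k => srwT_integrand_le_pairing α β m j x k hl)
    exact mul_nonneg (mul_nonneg (mul_nonneg (pow_nonneg (abs_nonneg _) _) (abs_nonneg _)) (abs_nonneg _))
      (pow_nonneg (Chat_one_nonneg k) _)
  have e : ∫ k, (lam * ((Dhat d k ^ (2 * m) * Mhat d k ^ 2) * Chat d 1 k ^ (2 * α)) +
        lam⁻¹ * ((Dhat d k ^ (2 * j) * DhatSym d x k ^ 2) * Chat d 1 k ^ (2 * β))) / 2 ∂P d =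
      (lam * (∫ k, (Dhat d k ^ (2 * m) * Mhat d k ^ 2) * Chat d 1 k ^ (2 * α) ∂P d) +
        lam⁻¹ * ∫ k, (Dhat d k ^ (2 * j) * DhatSym d x k ^ 2) * Chat d 1 k ^ (2 * β) ∂P d) / 2 := by
    rw [integral_div, integral_add (hA.const_mul lam) (hB.const_mul lam⁻¹), integral_const_mul,
      integral_const_mul]
  unfold srwT srwM2 srwW
  calc (∫ k, (|Dhat d k| ^ (m + j) * |DhatSym d x k| * |Mhat d k|) * Chat d 1 k ^ (α + β) ∂P d) / (2 * π) ^ d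
      ≤ ((lam * (∫ k, (Dhat d k ^ (2 * m) * Mhat d k ^ 2) * Chat d 1 k ^ (2 * α) ∂P d) +
          lam⁻¹ * ∫ k, (Dhat d k ^ (2 * j) * DhatSym d x k ^ 2) * Chat d 1 k ^ (2 * β) ∂P d) / 2) / (2 * π) ^ d :=
        div_le_div_of_nonneg_right (key.trans_eq e) (two_pi_pow_pos d).le
    _ = _ := by ring

/-- The `j = 0` form: `T_{α+β, m}(x) ≤ [M₂_{2α,m}]^{1/2} [L_{2β}(x)]^{1/2}`.
[cite: FitznerVanDerHofstad2016NoBLE, §5.2 (5.7), (5.9) p. 1091] -/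
theorem srwT_le_sqrt_srwM2_mul_srwL {α β : ℕ} (hα : 2 * (2 * α) + 1 ≤ d) (hβ : 2 * (2 * β) + 1 ≤ d)
    (m : ℕ) (x : Fin d → ℤ) :
    srwT d (α + β) m x ≤ Real.sqrt (srwM2 d (2 * α) m) * Real.sqrt (srwL d (2 * β) x) := by
  have h := srwT_le_sqrt_srwM2_mul_srwW hα hβ m 0 x
  rw [add_zero, srwW_zero] at h
  exact h

/-! ### `x`-space evaluation of `M₂` -/

/-- Pointwise expansion of the `M₂`-integrand:
`D̂^{2m} M̂² Ĉ^c = D̂^{2m+2} D̂^{(0)} Ĉ^c − (2/d)[D̂^{2m+1} D̂^{(0)} Ĉ^{c+1} − D̂^{2m+1} D̂^{(2e_i)} Ĉ^{c+1}]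
  + 4 D̂^{2m} (D̂^{sin})² Ĉ^{c+2}` (from `M̂ = D̂ − 2 D̂^{sin} Ĉ` and `D̂^{sin} = (2d)⁻¹ (1 − D̂^{(2e_i)})`).
[cite: FitznerVanDerHofstad2016NoBLE, (3.26) p. 1070, §5.2 (5.13) p. 1092–1093] -/
theorem srwM2_integrand_eq (hd : 1 ≤ d) (c m : ℕ) (i : Fin d) (k : Fin d → ℝ) :
    (Dhat d k ^ (2 * m) * Mhat d k ^ 2) * Chat d 1 k ^ c =
      (Dhat d k ^ (2 * m + 2) * DhatSym d 0 k) * Chat d 1 k ^ c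
        - 2 / d * ((Dhat d k ^ (2 * m + 1) * DhatSym d 0 k) * Chat d 1 k ^ (c + 1)
            - (Dhat d k ^ (2 * m + 1) * DhatSym d (Pi.single i 2) k) * Chat d 1 k ^ (c + 1))
        + 4 * ((Dhat d k ^ (2 * m) * Dsin d k ^ 2) * Chat d 1 k ^ (c + 2)) := by
  haveI : NeZero d := ⟨by omega⟩
  have hd0 : (d : ℝ) ≠ 0 := by exact_mod_cast (NeZero.ne d)
  have hS : DhatSym d (Pi.single i 2) k = 1 - 2 * d * Dsin d k := by
    rw [DhatSym_single_two, Dsin_eq_half_angle hd k]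
    field_simp
    ring
  rw [hS, DhatSym_zero, Mhat]
  field_simp
  ring

/-- **`x`-space evaluation of `M₂`**: for `d ≥ 2(c+2) + 1` and any axis `i`,
`M₂_{c,m} = I_{c,2m+2}(0) − (2/d) [I_{c+1,2m+1}(0) − I_{c+1,2m+1}(2e_i)] + 4 V_{c+2,2m}`.
[cite: FitznerVanDerHofstad2016NoBLE, §5.2 (5.13) p. 1092–1093] -/
theorem srwM2_eq {c : ℕ} (hd : 2 * (c + 2) + 1 ≤ d) (m : ℕ) (i : Fin d) :
    srwM2 d c m =
      srwI d c (2 * m + 2) 0 - 2 / d * (srwI d (c + 1) (2 * m + 1) 0 - srwI d (c + 1) (2 * m + 1) (Pi.single i 2))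
        + 4 * srwV d (c + 2) (2 * m) := by
  have hd1 : 1 ≤ d := by omega
  have hA := integrable_srwI_integrand (show 2 * c + 1 ≤ d by omega) (2 * m + 2) (0 : Fin d → ℤ)
  have hB := integrable_srwI_integrand (show 2 * (c + 1) + 1 ≤ d by omega) (2 * m + 1) (0 : Fin d → ℤ)
  have hB' := integrable_srwI_integrand (show 2 * (c + 1) + 1 ≤ d by omega) (2 * m + 1) (Pi.single i (2 : ℤ))
  have hV := integrable_srwV_integrand hd (2 * m) (d := d)
  have h3 : Integrable (fun k => 2 / (d : ℝ) * ((Dhat d k ^ (2 * m + 1) * DhatSym d 0 k) * Chat d 1 k ^ (c + 1)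
      - (Dhat d k ^ (2 * m + 1) * DhatSym d (Pi.single i 2) k) * Chat d 1 k ^ (c + 1))) (P d) :=
    (hB.sub hB').const_mul _
  have h13 : Integrable (fun k => (Dhat d k ^ (2 * m + 2) * DhatSym d 0 k) * Chat d 1 k ^ c
      - 2 / (d : ℝ) * ((Dhat d k ^ (2 * m + 1) * DhatSym d 0 k) * Chat d 1 k ^ (c + 1)
        - (Dhat d k ^ (2 * m + 1) * DhatSym d (Pi.single i 2) k) * Chat d 1 k ^ (c + 1))) (P d) :=
    hA.sub h3
  have h4 : Integrable (fun k => 4 * ((Dhat d k ^ (2 * m) * Dsin d k ^ 2) * Chat d 1 k ^ (c + 2))) (P d) :=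
    hV.const_mul _
  have e : ∫ k, (Dhat d k ^ (2 * m) * Mhat d k ^ 2) * Chat d 1 k ^ c ∂P d =
      ∫ k, ((Dhat d k ^ (2 * m + 2) * DhatSym d 0 k) * Chat d 1 k ^ c
        - 2 / (d : ℝ) * ((Dhat d k ^ (2 * m + 1) * DhatSym d 0 k) * Chat d 1 k ^ (c + 1)
            - (Dhat d k ^ (2 * m + 1) * DhatSym d (Pi.single i 2) k) * Chat d 1 k ^ (c + 1))
        + 4 * ((Dhat d k ^ (2 * m) * Dsin d k ^ 2) * Chat d 1 k ^ (c + 2))) ∂P d :=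
    integral_congr_ae (ae_of_all _ fun k => srwM2_integrand_eq hd1 c m i k)
  unfold srwM2 srwI srwV
  rw [e, integral_add h13 h4, integral_sub hA h3, integral_const_mul, integral_sub hB hB', integral_const_mul]
  ring

end Literature.Probability.FitznerVanDerHofstad2017
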